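import Mathlib
import HarnessLib
import Literature.Analysis.FluidPDE.VorticityCalculus
import Literature.Analysis.FluidPDE.ClassicalSolution
import Literature.Analysis.FluidPDE.SpaceTimeCalculus
import Literature.Analysis.FluidPDE.LocalBiotSavartCalculus
import Literature.Analysis.FluidPDE.TypeIAncientMild
import Summits.NavierStokesRegularity.NavierStokesRegularity.Theorems.AxisTwistDoorAveragedConeLiouvilleDefs
import Summits.NavierStokesRegularity.NavierStokesRegularity.Theorems.AxisTwistDoorAveragedConeLiouvilleCircleStokes
import Summits.NavierStokesRegularity.NavierStokesRegularity.Theorems.AxisTwistDoorAveragedConeLiouvilleCylFrame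
import Summits.NavierStokesRegularity.NavierStokesRegularity.Theorems.AxisTwistDoorAveragedConeLiouvilleCircleCalculus
import Summits.NavierStokesRegularity.NavierStokesRegularity.Theorems.PoloidalWindowDoorPoloidalWindowRigidityWindow
import Summits.NavierStokesRegularity.NavierStokesRegularity.Theorems.AdaptedFrequencyTangentFlowTransferAncientPressure

/-!
# Route `AxisTwistDoor`, crux `AveragedConeLiouville` (stmt-NavierStokesRegularity-26889), line `lrt_shell`,
# stub (1) `stub_circleSwirl : StubCircleSwirl` — brick B2b: THE CIRCLE-AVERAGED SWIRL IDENTITY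

For a classical solution `(u, q)` of the unit-viscosity, unforced Navier–Stokes system on an open time set `S`
(`IsClassicalNSSolutionOn S 1 0 u q`), the axis circulation `Γ(r,z,s) = circ u r z s = ∫₀^{2π} ⟪u(s)(cylPt r θ z), e_θ⟫ r dθ`
satisfies, at every `s ∈ S`, `r ≠ 0`, `z`, the CIRCLE-AVERAGED SWIRL EQUATION with remainder
`∂ₛΓ + v̄_r ∂ᵣΓ + v̄_z ∂_zΓ = ∂ᵣ²Γ − r⁻¹∂ᵣΓ + ∂_z²Γ + ℛ` (`circleSwirl_identity`): the `e_θ`-component of the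
momentum equation, multiplied by `r` and integrated over the circle — the time derivative passes under the integral
(`hasDerivAt_circ_s`, a smooth cut-off in time makes the integrand globally `C¹`), the convective term is LRT's circle
term `∮(v_r ω₃ − ω_r v₃) dl` by the Lamb form and periodicity (`…CircleCalculus.convective_pointwise`,
`integral_kinetic_eq_zero`), which is `v̄_r ∮ω₃ − v̄_z ∮ω_r − ℛ` (`circleTerm_eq`), the pressure term vanishes by
periodicity, and the viscous term `−∮ r (curl ω)_θ` (`Δu = −curl curl u`, `laplacian_eq_neg_curl_curl`) is
`∂ᵣ∮ω₃ dl − r⁻¹∮ω₃ dl − ∂_z ∮ω_r dl` (`viscous_pointwise`), i.e. `∂ᵣ²Γ − r⁻¹∂ᵣΓ + ∂_z²Γ` by `∂ᵣΓ = ∮ω₃ dl`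
(`…CircleStokes`) and `∂_zΓ = −∮ω_r dl` (`…CircleCalculus`).

With the tree's chain energy class ⇒ Type-I ancient mild (`isTypeIAncientMild_of_class`) ⇒ classical on `Iio 0` for one
smooth pressure (`exists_isClassicalNSSolutionOn_Iio_of_isTypeIAncientMild`), this gives the registered stub
`stub_circleSwirl : StubCircleSwirl` UNCONDITIONALLY (the suitable-weak / weak-gradient / `𝐈 < ∞` hypotheses of the stub
are not used).

WHAT THIS IS NOT: an identity for circle averages of classical solutions and of the route's class of HYPOTHETICAL blow-up
profiles; nothing about Navier–Stokes regularity (Clay A) is proved or claimed; this file supports, and does not close,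
stmt-…-26889.
-/

noncomputable section

-- the summit and its single sub-problem share the name (CONVENTIONS §1), as in every Theorems file
set_option linter.dupNamespace false

namespace Summit.NavierStokesRegularity.NavierStokesRegularity.Theorems.AveragedConeLiouville.CircleSwirl

open scoped Topology InnerProductSpace Laplacian
open Set Function MeasureTheory intervalIntegral Filter Metric
open Literature.Analysis Literature.Analysis.FunctionSpaces
open Literature.Analysis.FluidPDE hiding eR
open Summit.NavierStokesRegularity.NavierStokesRegularity.Theorems.AxisTwistDoorAveragedConeLiouvilleDefs
open Summit.NavierStokesRegularity.NavierStokesRegularity.Theorems.AveragedConeLiouville.CircleStokes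
open Summit.NavierStokesRegularity.NavierStokesRegularity.Theorems.AxisTwistDoorAveragedConeLiouvilleCylFrame
open Summit.NavierStokesRegularity.NavierStokesRegularity.Theorems.AveragedConeLiouville.CircleCalculus
open Summit.NavierStokesRegularity.NavierStokesRegularity.Theorems
  (exists_isClassicalNSSolutionOn_Iio_of_isTypeIAncientMild)
open Summit.NavierStokesRegularity.NavierStokesRegularity.Theorems.PoloidalWindowDoorPoloidalWindowRigidityWindow
  (isTypeIAncientMild_of_class)

variable {S : Set ℝ} {u : ℝ → EuclideanSpace ℝ (Fin 3) → EuclideanSpace ℝ (Fin 3)}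
  {q : ℝ → EuclideanSpace ℝ (Fin 3) → ℝ}

/-! ### The time derivative of `Γ` on an open time set -/

/-- **`∂ₛΓ = ∮ ⟪∂ₛu, e_θ⟫ r dθ`**: for a field jointly smooth on an open time set `S ∋ s`, the axis circulation is
differentiable in time at `s` with the derivative under the integral sign (a smooth cut-off in time supported in `S`
and equal to one near `s` makes the integrand globally `C¹`, then `SmoothParametricIntegral`). -/
theorem hasDerivAt_circ_s (hS : IsOpen S) (hu : IsSmoothSpaceTimeOn S u) {s : ℝ} (hs : s ∈ S) (r z : ℝ) :
    HasDerivAt (fun s' => circ u r z s')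
      (∫ θ in (0 : ℝ)..(2 * Real.pi), ⟪deriv (fun τ => u τ (cylPt r θ z)) s, eT θ⟫_ℝ * r) s := by
  -- a bump in time supported in `S`, equal to one near `s`
  obtain ⟨ε, hε, hball⟩ := Metric.isOpen_iff.1 hS s hs
  let χ : ContDiffBump s := ⟨ε / 4, ε / 2, by positivity, by linarith⟩
  have hχS : tsupport (χ : ℝ → ℝ) ⊆ S := by
    rw [χ.tsupport_eq]
    exact (closedBall_subset_ball (show χ.rOut < ε by show ε / 2 < ε; linarith)).trans hball
  -- the cut-off integrand, globally `C¹`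
  set H : ℝ × ℝ → ℝ := fun p => χ p.2 * (⟪u p.2 (cylPt r p.1 z), eT p.1⟫_ℝ * r) with hH
  have hHc : ContDiff ℝ 1 H := by
    rw [contDiff_iff_contDiffAt]
    intro p
    by_cases hp : p.2 ∈ S
    · have h1 : ContDiffAt ℝ 1 (fun p' : ℝ × ℝ => u p'.2 (cylPt r p'.1 z)) p := by
        have hux : ContDiffAt ℝ 1 (uncurry u) (p.2, cylPt r p.1 z) :=
          (hu.contDiffAt hS hp _).of_le (by norm_cast)
        have hg : ContDiffAt ℝ 1 (fun p' : ℝ × ℝ => (p'.2, cylPt r p'.1 z)) p :=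
          (contDiff_snd.prodMk (contDiff_cylPt_comp contDiff_const contDiff_fst contDiff_const)).contDiffAt
        exact hux.comp p hg
      have h2 : ContDiffAt ℝ 1 (fun p' : ℝ × ℝ => (χ : ℝ → ℝ) p'.2) p :=
        (χ.contDiff.comp contDiff_snd).contDiffAt
      have h3 : ContDiffAt ℝ 1 (fun p' : ℝ × ℝ => eT p'.1) p := (contDiff_eT.comp contDiff_fst).contDiffAt
      exact h2.mul ((h1.inner ℝ h3).mul contDiffAt_const)
    · -- off `S` the cut-off vanishes near `p`
      have h0 : (χ : ℝ → ℝ) =ᶠ[𝓝 p.2] 0 :=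
        notMem_tsupport_iff_eventuallyEq.1 fun h => hp (hχS h)
      have h0' : H =ᶠ[𝓝 p] fun _ => 0 := by
        have h0p : ∀ᶠ p' : ℝ × ℝ in 𝓝 p, (χ : ℝ → ℝ) p'.2 = 0 :=
          (continuous_snd.tendsto p).eventually h0
        filter_upwards [h0p] with p' hp'
        simp [hH, hp']
      exact contDiffAt_const.congr_of_eventuallyEq h0'
  -- pointwise time derivative of the cut-off integrand at `s`
  have hχ1 : (χ : ℝ → ℝ) =ᶠ[𝓝 s] 1 := χ.eventuallyEq_one
  have hg : ∀ θ : ℝ, HasDerivAt (fun s' => H (θ, s'))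
      (⟪deriv (fun τ => u τ (cylPt r θ z)) s, eT θ⟫_ℝ * r) s := fun θ => by
    have h1 : HasDerivAt (fun s' => ⟪u s' (cylPt r θ z), eT θ⟫_ℝ * r)
        (⟪deriv (fun τ => u τ (cylPt r θ z)) s, eT θ⟫_ℝ * r) s := by
      have h := (hu.hasDerivAt_timeLine hS hs (cylPt r θ z)).inner ℝ (hasDerivAt_const s (eT θ))
      simpa using h.mul_const r
    refine h1.congr_of_eventuallyEq ?_
    filter_upwards [hχ1] with s' hs'
    simp [hH, hs']
  have hD := hasDerivAt_intervalIntegral_of_contDiff hHc s hg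
  refine hD.congr_of_eventuallyEq ?_
  filter_upwards [hχ1] with s' hs'
  simp [hH, hs', circ]

/-! ### LRT's circle term versus the planner's remainder -/

/-- `∮(v_r ω₃ − ω_r v₃) dl = v̄_r ∮ω₃ dl − v̄_z ∮ω_r dl − ℛ` (linearity of the circle integral; `C¹` slice for
integrability). -/
theorem circleTerm_eq (v : ℝ → EuclideanSpace ℝ (Fin 3) → EuclideanSpace ℝ (Fin 3)) {s : ℝ}
    (hv : ContDiff ℝ 1 (v s)) (r z : ℝ) :
    circleTerm v r z s
      = meanR v r z s * vortCirc v r z s - meanZ v r z s * radVortCirc v r z s - remainder v r z s := by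
  have hp := continuous_cylPt_θ r z
  have hvc : Continuous fun θ => v s (cylPt r θ z) := hv.continuous.comp hp
  have hωc : Continuous fun θ => curl (v s) (cylPt r θ z) := (continuous_curl hv).comp hp
  have hvr : Continuous fun θ => ⟪v s (cylPt r θ z), eR θ⟫_ℝ := hvc.inner continuous_eR
  have hv3 : Continuous fun θ => ⟪v s (cylPt r θ z), e3⟫_ℝ := hvc.inner continuous_const
  have hωr : Continuous fun θ => ⟪curl (v s) (cylPt r θ z), eR θ⟫_ℝ := hωc.inner continuous_eR
  have hω3 : Continuous fun θ => ⟪curl (v s) (cylPt r θ z), e3⟫_ℝ := hωc.inner continuous_const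
  set R := meanR v r z s
  set Z := meanZ v r z s
  have hpt : ∀ θ : ℝ,
      ((⟪v s (cylPt r θ z), e3⟫_ℝ - Z) * ⟪curl (v s) (cylPt r θ z), eR θ⟫_ℝ
        - (⟪v s (cylPt r θ z), eR θ⟫_ℝ - R) * ⟪curl (v s) (cylPt r θ z), e3⟫_ℝ) * r
      = -((⟪v s (cylPt r θ z), eR θ⟫_ℝ * ⟪curl (v s) (cylPt r θ z), e3⟫_ℝ
            - ⟪curl (v s) (cylPt r θ z), eR θ⟫_ℝ * ⟪v s (cylPt r θ z), e3⟫_ℝ) * r)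
        + (R * (⟪curl (v s) (cylPt r θ z), e3⟫_ℝ * r) - Z * (⟪curl (v s) (cylPt r θ z), eR θ⟫_ℝ * r)) :=
    fun θ => by ring
  have hI1 : IntervalIntegrable (fun θ => -((⟪v s (cylPt r θ z), eR θ⟫_ℝ * ⟪curl (v s) (cylPt r θ z), e3⟫_ℝ
      - ⟪curl (v s) (cylPt r θ z), eR θ⟫_ℝ * ⟪v s (cylPt r θ z), e3⟫_ℝ) * r)) volume 0 (2 * Real.pi) :=
    (((hvr.mul hω3).sub (hωr.mul hv3)).mul continuous_const).neg.intervalIntegrable _ _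
  have hI2 : IntervalIntegrable (fun θ => R * (⟪curl (v s) (cylPt r θ z), e3⟫_ℝ * r)) volume 0 (2 * Real.pi) :=
    (continuous_const.mul (hω3.mul continuous_const)).intervalIntegrable _ _
  have hI3 : IntervalIntegrable (fun θ => Z * (⟪curl (v s) (cylPt r θ z), eR θ⟫_ℝ * r)) volume 0 (2 * Real.pi) :=
    (continuous_const.mul (hωr.mul continuous_const)).intervalIntegrable _ _
  have hrem : remainder v r z s = -circleTerm v r z s + (R * vortCirc v r z s - Z * radVortCirc v r z s) := by
    unfold remainder circleTerm vortCirc radVortCirc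
    rw [intervalIntegral.integral_congr (fun θ _ => hpt θ), intervalIntegral.integral_add hI1 (hI2.sub hI3),
      intervalIntegral.integral_neg, intervalIntegral.integral_sub hI2 hI3, intervalIntegral.integral_const_mul,
      intervalIntegral.integral_const_mul]
  linarith [hrem]

/-! ### The circle-averaged swirl identity for classical solutions -/

/-- **The circle-averaged swirl identity** for a classical solution of the unit-viscosity unforced Navier–Stokes system
on an open time set `S`: at `s ∈ S`, `r ≠ 0`, `z`,
`∂ₛΓ + v̄_r ∂ᵣΓ + v̄_z ∂_zΓ = ∂ᵣ²Γ − r⁻¹∂ᵣΓ + ∂_z²Γ + ℛ` (module docstring). -/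
theorem circleSwirl_identity (hS : IsOpen S) (hcl : IsClassicalNSSolutionOn S 1 0 u q) {s : ℝ} (hs : s ∈ S)
    {r : ℝ} (hr : r ≠ 0) (z : ℝ) :
    deriv (fun s' => circ u r z s') s + meanR u r z s * deriv (fun r' => circ u r' z s) r
        + meanZ u r z s * deriv (fun z' => circ u r z' s) z
      = deriv (fun r' => deriv (fun r'' => circ u r'' z s) r') r - r⁻¹ * deriv (fun r' => circ u r' z s) r
        + deriv (fun z' => deriv (fun z'' => circ u r z'' s) z') z + remainder u r z s := by
  have hC : ContDiff ℝ 2 (u s) := (hcl.contDiff_velocity hs).of_le (by norm_cast)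
  have hC1 : ContDiff ℝ 1 (u s) := hC.of_le (by norm_cast)
  have hω : ContDiff ℝ 1 (curl (u s)) := contDiff_curl (n := 1) (by exact_mod_cast hC)
  have hq1 : ContDiff ℝ 1 (q s) := (hcl.contDiff_pressure hs).of_le (by norm_cast)
  -- continuity of the integrands along the circle
  have hp := continuous_cylPt_θ r z
  have hwc : Continuous fun θ => u s (cylPt r θ z) := hC1.continuous.comp hp
  have hDc : Continuous fun θ => fderiv ℝ (u s) (cylPt r θ z) := (hC1.continuous_fderiv one_ne_zero).comp hp
  have hωc : Continuous fun θ => curl (u s) (cylPt r θ z) := (continuous_curl hC1).comp hp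
  have hDωc : Continuous fun θ => fderiv ℝ (curl (u s)) (cylPt r θ z) :=
    (hω.continuous_fderiv one_ne_zero).comp hp
  have hCc : Continuous fun θ => ⟪fderiv ℝ (u s) (cylPt r θ z) (u s (cylPt r θ z)), eT θ⟫_ℝ * r :=
    ((hDc.clm_apply hwc).inner continuous_eT).mul continuous_const
  have hVc : Continuous fun θ => -(⟪curl (curl (u s)) (cylPt r θ z), eT θ⟫_ℝ * r) :=
    ((((continuous_curl hω).comp hp).inner continuous_eT).mul continuous_const).neg
  have hgc : Continuous (gradient (q s)) := by
    show Continuous fun x => (InnerProductSpace.toDual ℝ (EuclideanSpace ℝ (Fin 3))).symm (fderiv ℝ (q s) x)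
    exact (InnerProductSpace.toDual ℝ (EuclideanSpace ℝ (Fin 3))).symm.continuous.comp
      (hq1.continuous_fderiv one_ne_zero)
  have hPc : Continuous fun θ => ⟪gradient (q s) (cylPt r θ z), eT θ⟫_ℝ * r :=
    ((hgc.comp hp).inner continuous_eT).mul continuous_const
  -- the momentum equation on the circle: `e_θ`-component times `r`
  have hmom : ∀ θ : ℝ,
      ⟪deriv (fun τ => u τ (cylPt r θ z)) s, eT θ⟫_ℝ * r
        = -(⟪curl (curl (u s)) (cylPt r θ z), eT θ⟫_ℝ * r) - ⟪gradient (q s) (cylPt r θ z), eT θ⟫_ℝ * r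
          - ⟪fderiv ℝ (u s) (cylPt r θ z) (u s (cylPt r θ z)), eT θ⟫_ℝ * r := fun θ => by
    have h := hcl.momentum s hs (cylPt r θ z)
    rw [timeDerivWithin_eq_deriv hS hs, one_smul, laplacian_eq_neg_curl_curl hC (hcl.divFree s hs)] at h
    have h' := congrArg (fun y => ⟪y, eT θ⟫_ℝ * r) h
    simp only [convect, Pi.zero_apply, add_zero, inner_add_left, inner_sub_left, inner_neg_left] at h'
    linarith [h']
  -- (T) the time derivative
  have hT := (hasDerivAt_circ_s hS hcl.smooth_velocity hs r z).deriv
  -- (C) the convective term is LRT's circle term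
  have hCv : ∫ θ in (0 : ℝ)..(2 * Real.pi), ⟪fderiv ℝ (u s) (cylPt r θ z) (u s (cylPt r θ z)), eT θ⟫_ℝ * r
      = circleTerm u r z s := by
    have hpt : ∀ θ : ℝ, ⟪fderiv ℝ (u s) (cylPt r θ z) (u s (cylPt r θ z)), eT θ⟫_ℝ * r
        = ⟪fderiv ℝ (u s) (cylPt r θ z) (eT θ), u s (cylPt r θ z)⟫_ℝ * r
          + (⟪u s (cylPt r θ z), eR θ⟫_ℝ * ⟪curl (u s) (cylPt r θ z), e3⟫_ℝ
              - ⟪curl (u s) (cylPt r θ z), eR θ⟫_ℝ * ⟪u s (cylPt r θ z), e3⟫_ℝ) * r := fun θ => by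
      rw [convective_pointwise]; ring
    have hI1 : IntervalIntegrable (fun θ => ⟪fderiv ℝ (u s) (cylPt r θ z) (eT θ), u s (cylPt r θ z)⟫_ℝ * r)
        volume 0 (2 * Real.pi) := (((hDc.clm_apply continuous_eT).inner hwc).mul continuous_const).intervalIntegrable _ _
    have hI2 : IntervalIntegrable (fun θ => (⟪u s (cylPt r θ z), eR θ⟫_ℝ * ⟪curl (u s) (cylPt r θ z), e3⟫_ℝ
        - ⟪curl (u s) (cylPt r θ z), eR θ⟫_ℝ * ⟪u s (cylPt r θ z), e3⟫_ℝ) * r) volume 0 (2 * Real.pi) :=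
      ((((hwc.inner continuous_eR).mul (hωc.inner continuous_const)).sub
        ((hωc.inner continuous_eR).mul (hwc.inner continuous_const))).mul continuous_const).intervalIntegrable _ _
    rw [intervalIntegral.integral_congr (fun θ _ => hpt θ), intervalIntegral.integral_add hI1 hI2,
      integral_kinetic_eq_zero hC1 r z, zero_add]
    rfl
  -- (V) the viscous term
  have hV : ∫ θ in (0 : ℝ)..(2 * Real.pi), -(⟪curl (curl (u s)) (cylPt r θ z), eT θ⟫_ℝ * r)
      = deriv (fun r' => vortCirc u r' z s) r - r⁻¹ * vortCirc u r z s
        - deriv (fun z' => radVortCirc u r z' s) z := by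
    have h1 := (hasDerivAt_vortCirc_r u hC r z).deriv
    have h2 := (hasDerivAt_radVortCirc_z u hC r z).deriv
    have h3 : ∫ θ in (0 : ℝ)..(2 * Real.pi), ⟪curl (u s) (cylPt r θ z), e3⟫_ℝ = r⁻¹ * vortCirc u r z s := by
      unfold vortCirc
      rw [intervalIntegral.integral_mul_const]
      field_simp
    have hIA : IntervalIntegrable (fun θ => ⟪fderiv ℝ (curl (u s)) (cylPt r θ z) (eR θ), e3⟫_ℝ * r)
        volume 0 (2 * Real.pi) := (((hDωc.clm_apply continuous_eR).inner continuous_const).mul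
          continuous_const).intervalIntegrable _ _
    have hIB : IntervalIntegrable (fun θ => ⟪fderiv ℝ (curl (u s)) (cylPt r θ z) e3, eR θ⟫_ℝ * r)
        volume 0 (2 * Real.pi) := (((hDωc.clm_apply continuous_const).inner continuous_eR).mul
          continuous_const).intervalIntegrable _ _
    have hIW : IntervalIntegrable (fun θ => ⟪curl (u s) (cylPt r θ z), e3⟫_ℝ) volume 0 (2 * Real.pi) :=
      (hωc.inner continuous_const).intervalIntegrable _ _
    rw [intervalIntegral.integral_add hIA hIW] at h1
    rw [intervalIntegral.integral_congr (fun θ _ => @CircleCalculus.viscous_pointwise (curl (u s)) r θ z),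
      intervalIntegral.integral_sub hIA hIB, h2]
    linarith [h1, h3]
  -- (P) the pressure term
  have hP := integral_pressure_eq_zero hq1 r z
  -- integrate the momentum identity over the circle
  have hint : ∫ θ in (0 : ℝ)..(2 * Real.pi), ⟪deriv (fun τ => u τ (cylPt r θ z)) s, eT θ⟫_ℝ * r
      = (deriv (fun r' => vortCirc u r' z s) r - r⁻¹ * vortCirc u r z s
          - deriv (fun z' => radVortCirc u r z' s) z) - 0 - circleTerm u r z s := by
    rw [intervalIntegral.integral_congr (fun θ _ => hmom θ),
      intervalIntegral.integral_sub (f := fun θ => -(⟪curl (curl (u s)) (cylPt r θ z), eT θ⟫_ℝ * r)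
          - ⟪gradient (q s) (cylPt r θ z), eT θ⟫_ℝ * r)
        ((hVc.sub hPc).intervalIntegrable _ _) (hCc.intervalIntegrable _ _),
      intervalIntegral.integral_sub (hVc.intervalIntegrable _ _) (hPc.intervalIntegrable _ _), hV, hP, hCv]
  -- the derivatives of `Γ` in `r` and `z`
  have hdr : deriv (fun r' => circ u r' z s) r = vortCirc u r z s := deriv_circ_eq_vortCirc u hC1 r z
  have hdz : deriv (fun z' => circ u r z' s) z = -radVortCirc u r z s := deriv_circ_z u hC1 r z
  have hdrr : deriv (fun r' => deriv (fun r'' => circ u r'' z s) r') r = deriv (fun r' => vortCirc u r' z s) r := by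
    rw [show (fun r' => deriv (fun r'' => circ u r'' z s) r') = fun r' => vortCirc u r' z s from
      funext fun r' => deriv_circ_eq_vortCirc u hC1 r' z]
  have hdzz : deriv (fun z' => deriv (fun z'' => circ u r z'' s) z') z
      = -deriv (fun z' => radVortCirc u r z' s) z := by
    rw [show (fun z' => deriv (fun z'' => circ u r z'' s) z') = -(fun z' => radVortCirc u r z' s) from
      funext fun z' => by rw [Pi.neg_apply]; exact deriv_circ_z u hC1 r z', deriv.neg]
  have hrem := circleTerm_eq u hC1 r z
  rw [hT, hdr, hdz, hdrr, hdzz]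
  linarith [hint, hrem]

/-- Both conjuncts of `CircleSwirlEquation` for a classical solution on an open time set containing `Iio 0`-times:
if `(u, q)` is classical on `Iio 0`, then `CircleSwirlEquation u`. -/
theorem circleSwirlEquation_of_classical (hcl : IsClassicalNSSolutionOn (Iio 0) 1 0 u q) :
    CircleSwirlEquation u := by
  intro s hs r hr z
  have hC1 : ContDiff ℝ 1 (u s) := (hcl.contDiff_velocity hs).of_le (by norm_cast)
  exact ⟨deriv_circ_eq_vortCirc u hC1 r z, circleSwirl_identity isOpen_Iio hcl hs hr.ne' z⟩

/-! ### The registered stub -/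

/-- **STUB (1) `stub_circleSwirl : StubCircleSwirl`** of the line `lrt_shell` (crux `AveragedConeLiouville`,
stmt-NavierStokesRegularity-26889), UNCONDITIONAL: a profile of the route's energy class (Type-I time rate, continuous
on the open lower slab, unit-viscosity Oseen–Duhamel between negative times, divergence-free slices) is a Type-I ancient
mild field (`isTypeIAncientMild_of_class`), hence a classical solution on `Iio 0` for one smooth pressure
(`exists_isClassicalNSSolutionOn_Iio_of_isTypeIAncientMild`), and `circleSwirlEquation_of_classical` applies.  The
suitable-weak, weak-gradient and `𝐈 < ∞` hypotheses of the stub are not needed. -/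
theorem stub_circleSwirl : StubCircleSwirl := by
  intro C v π H hrate hcont hmild hdiv _ _ _
  obtain ⟨p, hcl⟩ := exists_isClassicalNSSolutionOn_Iio_of_isTypeIAncientMild
    (isTypeIAncientMild_of_class hrate hcont hmild hdiv)
  exact circleSwirlEquation_of_classical hcl

end Summit.NavierStokesRegularity.NavierStokesRegularity.Theorems.AveragedConeLiouville.CircleSwirl

end
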